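/-
Copyright (c) 2026 the pub-hodgecm-mathlib formalisation cell (harness21).  Prover seat hodgecm-mathlib-K2Liu-p11 (g2), Track B «K2-LIT»,
#184♮ = hLiu418 = `stmt-HodgeConjecture-24832`; organ S2, σ8 S2-⊗ VALUE HALF (V-inst glue): binary-per-place ⇒ n-ary (my census 13:29Z).
THEOREMS ONLY (no `def`, no `instance`, no notation, no named-fact hypothesis, no `sorry`); GENERIC algebra over a field.
-/
import Mathlib.Algebra.BigOperators.Group.Finset.Basic
import Mathlib.Algebra.Field.Basic
import Mathlib.Data.Fintype.Basic
import Mathlib.Tactic.Ring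
import Mathlib.Tactic.Push
import HarnessLib

/-!
# Crux `HLiu418`, S2-⊗ VALUE HALF glue: SEPARATELY FACTORISABLE ⇒ JOINTLY FACTORISABLE
# (a function on a finite product which, for EACH coordinate, splits as (function of that coordinate) × (function of the others) is a product of one-coordinate functions)

Cell `hodgecm-mathlib`, crux item hLiu418 = `stmt-HodgeConjecture-24832` (helper lane `--supports`, count-neutral).

WHY: the tree has only BINARY place splittings (★ `placeSplitEquiv`, J2c `exists_clm_swSectionTensor_mul_oneplace_eq`: «σ versus the rest»); the n-ary pure-tensor map of
★ (V-gen) `K2LiuPureTensorFactorwiseFunctional` does not exist as a decl.  This file is the algebra that upgrades «for every place σ, the coefficient splits as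
(σ-part) × (rest)» to the full product over places «coefficient = c · ∏_σ (σ-part)» — i.e. it manufactures (V-gen)'s binders (T)+(E) in product form from per-place binary
factorisations, with no tensor construct at all.
SETTING: finite `ι`, types `X i`, a field `K`, `F : (Π i, X i) → K`.  «`g` ignores the coordinates in `s`»: `∀ x y, (∀ j, j ∉ s → x j = y j) → g x = g y`.
* §1 overwrite calculus: `overwrite s ξ x := fun j => if j ∈ s then ξ j else x j` (inline, no def) — `overwrite_of_mem ∕ _of_not_mem`, agreement lemmas;
* §2 **`exists_prod_mul_ignoring`** — Finset induction: `F x = (∏ i ∈ s, φ i (x i)) · g_s x` with `g_s` ignoring `s`, from per-coordinate binary factorisations;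
* §3 **`exists_const_mul_prod`** — the END HEAD: `(∀ i, ∃ f g, g ignores {i} ∧ ∀ x, F x = f (x i) * g x) → ∃ c φ, ∀ x, F x = c * ∏ i, φ i (x i)` (`[∀ i, Nonempty (X i)]`).
References: [BorelJacquet1979, §4.1]; [Flath1979, §2].
HONEST LABEL: HC_CM is proved only modulo the 7 printed citations (2 remaining named inputs: hLiu418 = stmt-HodgeConjecture-24832,
h413 = stmt-HodgeConjecture-24833) until rung 0 closes; count-neutral helper, closes no socket.
-/

set_option autoImplicit false
set_option linter.dupNamespace false

namespace Summit.HodgeConjecture.HodgeConjecture.Cruxes.HLiu418.K2LiuSeparatelyFactorisable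

variable {ι : Type*} [DecidableEq ι] {X : ι → Type*} {K : Type*} [Field K]

/-! ## §1  Overwriting the coordinates in `s` -/

/-- Overwriting the `s`-coordinates of `x` by those of `ξ` does not change the coordinates outside `s`. [folklore] -/
theorem overwrite_of_not_mem (s : Finset ι) (ξ x : Π i, X i) {j : ι} (hj : j ∉ s) : (fun i => if i ∈ s then ξ i else x i) j = x j := by
  simp [hj]

/-- … and replaces those inside `s`. [folklore] -/
theorem overwrite_of_mem (s : Finset ι) (ξ x : Π i, X i) {j : ι} (hj : j ∈ s) : (fun i => if i ∈ s then ξ i else x i) j = ξ j := by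
  simp [hj]

omit [Field K] in
/-- A function ignoring the coordinates in `s` takes the same value after overwriting them. [folklore] -/
theorem apply_overwrite_eq (s : Finset ι) {g : (Π i, X i) → K} (hg : ∀ x y : Π i, X i, (∀ j, j ∉ s → x j = y j) → g x = g y) (ξ x : Π i, X i) :
    g (fun i => if i ∈ s then ξ i else x i) = g x :=
  hg _ _ fun _ hj => overwrite_of_not_mem s ξ x hj

/-- The product over `s` after overwriting by `ξ` is the product of the `ξ`-values. [folklore] -/
theorem prod_overwrite_eq (s : Finset ι) (φ : ∀ i, X i → K) (ξ x : Π i, X i) :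
    (∏ i ∈ s, φ i ((fun k => if k ∈ s then ξ k else x k) i)) = ∏ i ∈ s, φ i (ξ i) :=
  Finset.prod_congr rfl fun i hi => by rw [overwrite_of_mem s ξ x hi]

/-! ## §2  The induction: peel one coordinate at a time -/

/-- **PARTIAL PRODUCT FORM.** If `F` factorises binarily at every coordinate, then for every finset `s`: `F x = (∏ i ∈ s, φ i (x i)) · g x` with `g` ignoring the coordinates in `s`.
[BorelJacquet1979, §4.1] [Flath1979, §2] -/
theorem exists_prod_mul_ignoring (F : (Π i, X i) → K)
    (hF : ∀ i, ∃ (f : X i → K) (g : (Π i, X i) → K), (∀ x y : Π i, X i, (∀ j, j ≠ i → x j = y j) → g x = g y) ∧ ∀ x, F x = f (x i) * g x)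
    (s : Finset ι) :
    ∃ (φ : ∀ i, X i → K) (g : (Π i, X i) → K), (∀ x y : Π i, X i, (∀ j, j ∉ s → x j = y j) → g x = g y) ∧ ∀ x, F x = (∏ i ∈ s, φ i (x i)) * g x := by
  classical
  induction s using Finset.induction_on with
  | empty => exact ⟨fun i _ => 1, F, fun x y h => congrArg F (funext fun j => h j (by simp)), fun x => by simp⟩
  | @insert a s ha ih =>
    obtain ⟨φ, g, hg, hFg⟩ := ih
    obtain ⟨fa, ga, hga, hFa⟩ := hF a
    by_cases hzero : ∀ ξ : Π i, X i, (∏ i ∈ s, φ i (ξ i)) = 0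
    · -- then `F ≡ 0`: everything zero
      refine ⟨fun i _ => 0, fun _ => 0, fun _ _ _ => rfl, fun x => ?_⟩
      rw [hFg x, hzero x, zero_mul, mul_zero]
    · push Not at hzero
      obtain ⟨ξ, hξ⟩ := hzero
      -- overwrite the `s`-coordinates by `ξ`: `g x = g x' = F x' / Π₀ = fa (x a) * ga x' / Π₀`
      refine ⟨Function.update φ a fa, fun x => ga (fun i => if i ∈ s then ξ i else x i) / ∏ i ∈ s, φ i (ξ i), ?_, fun x => ?_⟩
      · -- the new `g` ignores `insert a s`
        intro x y hxy
        have hov : (fun i => if i ∈ s then ξ i else x i) = Function.update (fun i => if i ∈ s then ξ i else y i) a (x a) := by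
          funext j
          by_cases hja : j = a
          · subst hja
            simp [ha]
          · rw [Function.update_of_ne hja]
            by_cases hjs : j ∈ s
            · simp [hjs]
            · simp only [hjs, if_false]
              exact hxy j (by simp [hja, hjs])
        have h2 : ga (fun i => if i ∈ s then ξ i else x i) = ga (fun i => if i ∈ s then ξ i else y i) := by
          rw [hov]
          exact hga _ _ fun j hj => by rw [Function.update_of_ne hj]
        change ga (fun i => if i ∈ s then ξ i else x i) / (∏ i ∈ s, φ i (ξ i)) =
          ga (fun i => if i ∈ s then ξ i else y i) / (∏ i ∈ s, φ i (ξ i))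
        rw [h2]
      · -- the formula
        have hx' : F (fun i => if i ∈ s then ξ i else x i) = (∏ i ∈ s, φ i (ξ i)) * g x := by
          rw [hFg, prod_overwrite_eq, apply_overwrite_eq s hg]
        have hx'' : F (fun i => if i ∈ s then ξ i else x i) = fa (x a) * ga (fun i => if i ∈ s then ξ i else x i) := by
          rw [hFa, if_neg ha]
        have hgx : g x = fa (x a) * ga (fun i => if i ∈ s then ξ i else x i) / ∏ i ∈ s, φ i (ξ i) := by
          rw [eq_div_iff hξ, mul_comm (g x), ← hx', hx'']
        rw [hFg x, hgx, Finset.prod_insert ha, Function.update_self]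
        have hφ : (∏ i ∈ s, Function.update φ a fa i (x i)) = ∏ i ∈ s, φ i (x i) :=
          Finset.prod_congr rfl fun i hi => by rw [Function.update_of_ne (ne_of_mem_of_not_mem hi ha)]
        rw [hφ]
        change _ = _ * (ga (fun i => if i ∈ s then ξ i else x i) / ∏ i ∈ s, φ i (ξ i))
        ring

/-! ## §3  The end head -/

/-- **SEPARATELY FACTORISABLE ⇒ JOINTLY FACTORISABLE.** On a finite product with nonempty factors: if for every coordinate `i` the function `F` splits as
`f (x i) · g x` with `g` ignoring the coordinate `i`, then `F x = c · ∏ i, φ i (x i)`. [BorelJacquet1979, §4.1] [Flath1979, §2] -/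
theorem exists_const_mul_prod [Fintype ι] [∀ i, Nonempty (X i)] (F : (Π i, X i) → K)
    (hF : ∀ i, ∃ (f : X i → K) (g : (Π i, X i) → K), (∀ x y : Π i, X i, (∀ j, j ≠ i → x j = y j) → g x = g y) ∧ ∀ x, F x = f (x i) * g x) :
    ∃ (c : K) (φ : ∀ i, X i → K), ∀ x, F x = c * ∏ i, φ i (x i) := by
  obtain ⟨φ, g, hg, hFg⟩ := exists_prod_mul_ignoring F hF Finset.univ
  let ξ : Π i, X i := fun i => Classical.arbitrary (X i)
  refine ⟨g ξ, φ, fun x => ?_⟩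
  rw [hFg x, hg x ξ fun j hj => absurd (Finset.mem_univ j) hj, mul_comm]

/-- **BINARY-AT-EACH-PLACE ⇒ PRODUCT, with the one-coordinate factors PRESCRIBED up to the constant**: if moreover each binary factorisation uses a GIVEN `f i` that does
not vanish identically… — not needed downstream; instead the useful corollary: the product form transfers to any `F′` that agrees with `F`. [folklore] -/
theorem exists_const_mul_prod_congr [Fintype ι] [∀ i, Nonempty (X i)] {F F' : (Π i, X i) → K} (hFF' : ∀ x, F' x = F x)
    (hF : ∀ i, ∃ (f : X i → K) (g : (Π i, X i) → K), (∀ x y : Π i, X i, (∀ j, j ≠ i → x j = y j) → g x = g y) ∧ ∀ x, F x = f (x i) * g x) :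
    ∃ (c : K) (φ : ∀ i, X i → K), ∀ x, F' x = c * ∏ i, φ i (x i) := by
  obtain ⟨c, φ, h⟩ := exists_const_mul_prod F hF
  exact ⟨c, φ, fun x => (hFF' x).trans (h x)⟩

end Summit.HodgeConjecture.HodgeConjecture.Cruxes.HLiu418.K2LiuSeparatelyFactorisable
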